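import Summits.ABC.IUTFork.Conditional.Cor312LicenceTripleHullCellRefuteMPinned
import Summits.ABC.IUTFork.Conditional.RefBandsFrey160412424963707ThreeCells
import Summits.ABC.IUTFork.Cor312GenuineKWildExactTriple
import Summits.ABC.IUTFork.Cor312ThetaSideAssemblyM
import HarnessLib

/-!
# R-W «W:REF-BAND-REST», M LINE: `7³·29⁵·151² + 2⁴·5¹⁶·97·919 = 3²⁷·13⁴` — the hull licence S_H at the own-ideles M-level setting is REFUTED at EVERY genuine
# Θ-volume datum over `(ratPoint (a/c), l)` for EVERY prime `11 ≤ l ≤ 159389`, `l ≠ 3`, at the pole `p = 3` with the EXACT K-fibre type `e = 10·l`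
# (row «W:REF-EXACT-M-TWIN», pinned part: the M twins of abc-iut-C-cert-1's `RefBandsFrey160412424963707Three`)

PROOF-ONLY file (D-0012; 0 definitions, 0 `Prop` facts, no instance) of the abc-iut cell — D-0079 RESCUE sub-cell R-W «WINDOW Θ-SIDE INEQUALITY», seat
abc-iut-W-neg-1 (gen 6). TAKES NO SIDE on [IUTchIII] Cor. 3.12 (S. Mochizuki, *Inter-universal Teichmüller theory III*, Cor. 3.12 p. 173–174; Step (xi-f)
p. 184) or on any author; «refuted as typed» ≠ «refuted in print». abc-iut-C-cert-1's K-line band `WRow.not_licence_frey160412424963707_three_band` /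
`WRow.not_exists_qPinned_and_hull_…` (`11 ≤ l ≤ 159389`; abc-iut-w5-d009's pinned socket `WRow.not_licence_triple_of_not_hullCell` at `p = 3` with the EXACT type `e = 10·l`
of `GenuineK.absRamificationIdx_kOf_frey160412424963707_three`, `Cor312GenuineKWildExactTriple`: `v₃(abc) = 27`, `9 ∣ D` ⇒ SPLIT, `3 ∤ 10l` so the place is TAME) had an M
twin only on scattered levels (abc-iut-w4-d094's `…_wild` list `l ∈ {29, 251, …, 397}`, the rad rows at `7, 11, 13`, the `p = 29` band `21 … 27`): the CLASS-ROBUST wild M engine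
cannot reach the band (desk, this seat: the `A = 30` member's δ-cell stops refuting at `l = 17681`), the pinned type lives on the K fibre. THIS FILE applies this seat's
K→M pinned-type socket (`Cor312LicenceTripleHullCellRefuteMPinned`: `WRowM.not_licence_triple_of_not_hullCell_kFibre` / `GenuineM.…_kFibre`, the K-fibre type transported
to the M members along `placeOfM = placeOf`) with abc-iut-C-cert-1's integer cells `RefBand.cells_frey160412424963707_three_band` and `RefBand.frey160412424963707_three_fac` BY
NAME: **`WRowM.not_licence_frey160412424963707_three_band`** (every idele datum `r`, every analytic `logv`: `¬ Licence (settingPrVolSharpM T.D hlog (tOfIdeleData T.D r) (tqM … r) …)`)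
and **`GenuineM.not_pilotKummerCompatHull_triple_frey160412424963707_three_band`** (the M books' instance shape), SAME level binders as the K theorems; the M place over `3`
is `placeOfPrimeQ 3`. READING (neutral): at `(a/c, l)`, `11 ≤ l ≤ 159389` prime, the M books' per-datum S_H object FAILS at EVERY genuine datum, exactly as the K books'
does; the inhabited side, admissibility / (P6) / NON-EMPTINESS are NOT claimed; record counts UNCHANGED. HONEST SCOPE: OUR sharp containers and Dupuy–Hilado's typed
(Ind1)/(Ind2); STRONGER-THAN-PRINT set-level reading of Step (xi-f); nothing about the printed GLOBAL inequality, the number-level `Cor22.Cor312AtDatum` or any author's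
intended hull; typed ≠ proved; instantiated ≠ endorsed; no abc claim. [cite: Mochizuki2012, IUTchI Ex. 3.2 (iv) p. 71; IUTchIII Cor. 3.12 Step (xi-f) p. 184; IUTchIV
Prop. 1.1 p. 9, Prop. 1.2 (i)(ii) p. 10, Thm. 1.10 p. 22, Cor. 2.2 (ii) proof (P5) p. 46] [cite: DupuyHilado2025, §3.4, §4.9, §4.12] [cite: Serre1972, §1.11–§1.12]
[claim: Mochizuki2012, status: disputed] for every IUT sentence.
-/

noncomputable section

open Set Function Metric NumberField IsDedekindDomain

namespace Summit.ABC.IUTFork.Conditional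

open Thm311 Thm311.Real Cor312 Cor312Vol Cor312Prov Literature.IUT.LogThetaLattice Literature.IUT.LogVolume
  Literature.IUT.HodgeTheaters Literature.IUT.LogVolume.ThetaData Literature.IUT.LogVolume.Cor22
open Literature.NumberTheory.NumberFields Literature.NumberTheory.GaloisRepresentations.Ultrametric
open Literature.NumberTheory.DiophantineGeometry Literature.NumberTheory.DiophantineGeometry.GenEll Summit.ABC.ABC.Theorems
open Summit.ABC.IUTFork.Repair.RH.HullThresholdExact

/-- **`7³·29⁵·151² + 2⁴·5¹⁶·97·919 = 3²⁷·13⁴`, every prime `11 ≤ l ≤ 159389`, `l ≠ 3`, M LINE, every idele datum: `¬ Thm311ToCor312.Licence (settingPrVolSharpM T.D hlog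
(tOfIdeleData T.D r) (tqM … r) …)`** at every genuine Θ-volume datum over `(ratPoint (a/c), l)` — the M twin of abc-iut-C-cert-1's `WRow.not_licence_frey160412424963707_three_band`:
this seat's `WRowM.not_licence_triple_of_not_hullCell_kFibre` at `p = 3` (`placeOfPrimeQ 3`) with the EXACT K-fibre type `e₀ = 10l`
(`GenuineK.absRamificationIdx_kOf_frey160412424963707_three`), `P = 270`, top label, cells `RefBand.cells_frey160412424963707_three_band` BY NAME.
[cite: Mochizuki2012, IUTchIII Cor. 3.12 Step (xi-f) p. 184; IUTchIV Prop. 1.1 p. 9, Prop. 1.2 (i)(ii) p. 10] [cite: DupuyHilado2025, §4.9] [claim: Mochizuki2012, status: disputed] -/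
theorem WRowM.not_licence_frey160412424963707_three_band {l : ℕ} (hl : l.Prime) (hlo : 11 ≤ l) (hhi : l ≤ 159389) (hne : l ≠ 3)
    (T : Cor22.ThetaVolumeDatumAt (ratPoint (((7 ^ 3 * 29 ^ 5 * 151 ^ 2 : ℕ) : ℚ) / (3 ^ 27 * 13 ^ 4 : ℕ))) l) :
    letI := T.instFieldF; letI := T.instNumberFieldF; letI := T.instAlgebraF; letI := T.instFieldK
    letI := T.instNumberFieldK; letI := T.instAlgebraK; letI := T.instFieldFbar; letI := T.instAlgebraFbar
    letI := T.instAlgebraKFbar; letI := T.instIsElliptic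
    ∀ {logvK : PadicLogsVal T.K} (hlog : LogvAnalyticVal logvK) (r : ThetaData.IdeleData T.D) (M : Type) [Field M] [NumberField M]
      (archPk : ∀ (j : (thetaIndexOfInitial T.D).Label) (vQ : (thetaIndexOfInitial T.D).VQ),
        Set ((logShellsOfInitialDH T.D logvK).Packet j vQ))
      (archSub : ∀ (j : (thetaIndexOfInitial T.D).Label) (v : (thetaIndexOfInitial T.D).V),
        Set ((logShellsOfInitialDH T.D logvK).Packet j ((thetaIndexOfInitial T.D).over v)))
      (Ψ : ℤ → ∀ v : (thetaIndexOfInitial T.D).V, v ∈ (thetaIndexOfInitial T.D).Vbad →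
        Set ((logShellsOfInitialDH T.D logvK).StarPacket v))
      (act : ℤ → ∀ v : (thetaIndexOfInitial T.D).V, v ∈ (thetaIndexOfInitial T.D).Vbad →
        (logShellsOfInitialDH T.D logvK).StarPacket v → Module.End ℚ ((logShellsOfInitialDH T.D logvK).StarPacket v))
      (Mmod : ℤ → ∀ j : (thetaIndexOfInitial T.D).LabelStar, Set ((logShellsOfInitialDH T.D logvK).GlobalPacket j.1))
      (region : ℤ → ∀ j : (thetaIndexOfInitial T.D).LabelStar, FinDivisor M → ∀ vQ : (thetaIndexOfInitial T.D).VQ,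
        Set ((logShellsOfInitialDH T.D logvK).Packet j.1 vQ))
      (n : ℤ) {HT : Type} {LogLink : HT → HT → Type} {IsFull : ∀ {s t : HT}, LogLink s t → Prop}
      (lat : LGPGaussianLogThetaLattice LogLink IsFull)
      {Frd : Type} {IsoF : Frd → Frd → Type} {Ob : Frd → Type} {realify : Frd → Frd} {Strip : Type}
      {IsoS : Strip → Strip → Type}
      {Mv : ∀ v : (thetaIndexOfInitial T.D).V, v ∈ (thetaIndexOfInitial T.D).Vbad → Type} [∀ v h, Monoid (Mv v h)]
      (sig : GlobalLGPFrobenioidSignature (thetaIndexOfInitial T.D).lstar (thetaIndexOfInitial T.D).V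
        (· ∈ (thetaIndexOfInitial T.D).Vbad) Frd IsoF Ob realify Strip IsoS Mv)
      (split : SplittingMonoids Mv) {ObΔ : Type}
      {N : ∀ v : (thetaIndexOfInitial T.D).V, v ∈ (thetaIndexOfInitial T.D).Vbad → Type} [∀ v h, Monoid (N v h)]
      (qData : QPilotData ObΔ N)
      (htq0 : ∀ (u : FinitePlace ℚ) (x : (thetaIndexOfInitial T.D).Fibre (Val.non u)),
        tqM T.D (ratChar u) u (natCast_ratChar_mem u) r x ≠ 0)
      (Sq : Finset (FinitePlace ℚ))
      (htq1 : ∀ (u : FinitePlace ℚ) (x : (thetaIndexOfInitial T.D).Fibre (Val.non u)), u ∉ Sq →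
        ‖tqM T.D (ratChar u) u (natCast_ratChar_mem u) r x‖ = 1),
      ¬ Thm311ToCor312.Licence
        (settingPrVolSharpM T.D hlog (tOfIdeleData T.D r) (fun u x => tqM T.D (ratChar u) u (natCast_ratChar_mem u) r x) M archPk
          archSub Ψ act Mmod region n lat sig split qData htq0 Sq htq1) := by
  have hhi' : l ≤ 159391 := by omega
  have hodd : Odd l := hl.odd_of_ne_two (by omega)
  have hpe : ¬ (3 : ℕ) ∣ 10 * l := by
    intro h
    rcases (Nat.Prime.dvd_mul (by norm_num : Nat.Prime 3)).mp h with h1 | h1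
    · revert h1; norm_num
    · exact hne (((Nat.prime_dvd_prime_iff_eq (by norm_num : Nat.Prime 3) hl).mp h1).symm)
  have hi : (l - 1) / 2 - 1 + 1 ≤ (l - 1) / 2 := by
    have h3 : 3 ≤ l := by omega
    omega
  obtain ⟨a₀, h1, h2, h3⟩ := RefBand.cells_frey160412424963707_three_band hlo hhi' hodd (i := (l - 1) / 2 - 1) (by omega)
  have hP : 10 * l * (7 ^ 3 * 29 ^ 5 * 151 ^ 2 * (2 ^ 4 * 5 ^ 16 * 97 * 919) * (3 ^ 27 * 13 ^ 4)).factorization 3 = l * 270 := by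
    rw [RefBand.frey160412424963707_three_fac]; ring
  intro logvK hlog
  exact WRowM.not_licence_triple_of_not_hullCell_kFibre isABCTriple_frey160412424963707 T (placeOfPrimeQ 3 (by norm_num)) 3
    (ratChar_placeOfPrimeQ 3 (by norm_num)) Nat.prime_three (by norm_num) (show (3 : ℕ) ≠ l by omega) (by norm_num) (e₀ := 10 * l) (P := 270)
    (i := (l - 1) / 2 - 1) (a₀ := a₀) hpe (GenuineK.absRamificationIdx_kOf_frey160412424963707_three T (by omega)) hP hi h1 h2 h3 hlog

/-- **… in the M books' instance shape** (own ideles, analytic `logv`, pinned reading, every free binder): the M twin of abc-iut-C-cert-1's K books'-shape reading of the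
same band — this seat's `GenuineM.not_pilotKummerCompatHull_triple_of_not_hullCell_kFibre`, same inputs BY NAME.
[cite: Mochizuki2012, IUTchIII Cor. 3.12 Step (xi-f) p. 184; IUTchIV Prop. 1.2 (i)(ii) p. 10] [cite: DupuyHilado2025, §4.9] [claim: Mochizuki2012, status: disputed] -/
theorem GenuineM.not_pilotKummerCompatHull_triple_frey160412424963707_three_band {l : ℕ} (hl : l.Prime) (hlo : 11 ≤ l) (hhi : l ≤ 159389) (hne : l ≠ 3)
    (T : Cor22.ThetaVolumeDatumAt (ratPoint (((7 ^ 3 * 29 ^ 5 * 151 ^ 2 : ℕ) : ℚ) / (3 ^ 27 * 13 ^ 4 : ℕ))) l) :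
    letI := T.instFieldF; letI := T.instNumberFieldF; letI := T.instAlgebraF; letI := T.instFieldK
    letI := T.instNumberFieldK; letI := T.instAlgebraK; letI := T.instFieldFbar; letI := T.instAlgebraFbar
    letI := T.instAlgebraKFbar; letI := T.instIsElliptic
    ∀ (M : Type) [Field M] [NumberField M]
      (archPk : ∀ (j : (thetaIndexOfInitial T.D).Label) (vQ : (thetaIndexOfInitial T.D).VQ),
        Set ((logShellsOfInitialDH T.D (analyticLogvVal T.K)).Packet j vQ))
      (archSub : ∀ (j : (thetaIndexOfInitial T.D).Label) (v : (thetaIndexOfInitial T.D).V),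
        Set ((logShellsOfInitialDH T.D (analyticLogvVal T.K)).Packet j ((thetaIndexOfInitial T.D).over v)))
      (Ψ : ℤ → ∀ v : (thetaIndexOfInitial T.D).V, v ∈ (thetaIndexOfInitial T.D).Vbad →
        Set ((logShellsOfInitialDH T.D (analyticLogvVal T.K)).StarPacket v))
      (act : ℤ → ∀ v : (thetaIndexOfInitial T.D).V, v ∈ (thetaIndexOfInitial T.D).Vbad →
        (logShellsOfInitialDH T.D (analyticLogvVal T.K)).StarPacket v →
          Module.End ℚ ((logShellsOfInitialDH T.D (analyticLogvVal T.K)).StarPacket v))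
      (Mmod : ℤ → ∀ j : (thetaIndexOfInitial T.D).LabelStar, Set ((logShellsOfInitialDH T.D (analyticLogvVal T.K)).GlobalPacket j.1))
      (region : ℤ → ∀ j : (thetaIndexOfInitial T.D).LabelStar, FinDivisor M → ∀ vQ : (thetaIndexOfInitial T.D).VQ,
        Set ((logShellsOfInitialDH T.D (analyticLogvVal T.K)).Packet j.1 vQ))
      (frobAdm : ℤ → ℤ → ∀ (j : (thetaIndexOfInitial T.D).Label) (vQ : (thetaIndexOfInitial T.D).VQ),
        Set ((logShellsOfInitialDH T.D (analyticLogvVal T.K)).Packet j vQ) → Prop)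
      (frobLogvol : ℤ → ℤ → ∀ (j : (thetaIndexOfInitial T.D).Label) (vQ : (thetaIndexOfInitial T.D).VQ),
        Set ((logShellsOfInitialDH T.D (analyticLogvVal T.K)).Packet j vQ) → ℝ)
      (frobΨ : ℤ → ℤ → ∀ v : (thetaIndexOfInitial T.D).V, v ∈ (thetaIndexOfInitial T.D).Vbad →
        Set ((logShellsOfInitialDH T.D (analyticLogvVal T.K)).StarPacket v))
      (frobMmod : ℤ → ℤ → ∀ j : (thetaIndexOfInitial T.D).LabelStar, Set ((logShellsOfInitialDH T.D (analyticLogvVal T.K)).GlobalPacket j.1))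
      (unitImage : ℤ → ℤ → ℕ → ∀ (j : (thetaIndexOfInitial T.D).Label) (vQ : (thetaIndexOfInitial T.D).VQ),
        Set ((logShellsOfInitialDH T.D (analyticLogvVal T.K)).Packet j vQ))
      (ballImage : ℤ → ℤ → ∀ (j : (thetaIndexOfInitial T.D).Label) (vQ : (thetaIndexOfInitial T.D).VQ),
        Set ((logShellsOfInitialDH T.D (analyticLogvVal T.K)).Packet j vQ))
      (thetaDiv : ℤ → ℤ → LgpDivisor M (thetaIndexOfInitial T.D).lstar)
      (n : ℤ) {HT : Type} {LogLink : HT → HT → Type} {IsFull : ∀ {s t : HT}, LogLink s t → Prop}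
      (lat : LGPGaussianLogThetaLattice LogLink IsFull)
      {Frd : Type} {IsoF : Frd → Frd → Type} {Ob : Frd → Type} {realify : Frd → Frd} {Strip : Type}
      {IsoS : Strip → Strip → Type} {Mv : ∀ v : (thetaIndexOfInitial T.D).V, v ∈ (thetaIndexOfInitial T.D).Vbad → Type}
      [∀ v h, Monoid (Mv v h)]
      (sig : GlobalLGPFrobenioidSignature (thetaIndexOfInitial T.D).lstar (thetaIndexOfInitial T.D).V
        (· ∈ (thetaIndexOfInitial T.D).Vbad) Frd IsoF Ob realify Strip IsoS Mv)
      (split : SplittingMonoids Mv) {ObΔ : Type} {N : ∀ v : (thetaIndexOfInitial T.D).V, v ∈ (thetaIndexOfInitial T.D).Vbad → Type}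
      [∀ v h, Monoid (N v h)] (qData : QPilotData ObΔ N)
      (qK : ∀ v : (thetaIndexOfInitial T.D).V, v ∈ (thetaIndexOfInitial T.D).Vbad →
        Set ((logShellsOfInitialDH T.D (analyticLogvVal T.K)).StarPacket v)),
      ¬ Cor312Vol.PilotKummerCompatHull
        (LatticeSituation.ofShells (logShellsOfInitialDH T.D (analyticLogvVal T.K)) M archPk archSub
          (summandPiecesPrM T.D (logvAnalyticVal_analyticLogvVal (K := T.K))).Adm (summandPiecesPrM T.D (logvAnalyticVal_analyticLogvVal (K := T.K))).logvol Ψ act Mmod region frobAdm frobLogvol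
          frobΨ frobMmod unitImage ballImage thetaDiv)
        (settingPrVolSharpM T.D (logvAnalyticVal_analyticLogvVal (K := T.K)) (tOfIdeleData T.D (ideleDataOf T.D T.isVolumeInputOf))
          (fun u x => tqM T.D (ratChar u) u (natCast_ratChar_mem u) (ideleDataOf T.D T.isVolumeInputOf) x) M archPk archSub Ψ act Mmod region n lat sig split qData
          (fun u x => tqM_ne_zero T.D (ratChar u) u (natCast_ratChar_mem u) (ideleDataOf T.D T.isVolumeInputOf) x)
          (GenuineM.finite_ratPlaces_under_S T.D).toFinset
          (fun u x hu => norm_tqM_eq_one_of_not_mem T.D (ratChar u) u (natCast_ratChar_mem u) (ideleDataOf T.D T.isVolumeInputOf) x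
            fun hx => hu ((Set.Finite.mem_toFinset _).mpr ⟨x, hx⟩)))
        (fun _ => Cor312.Setting.qRegion
          (settingPrVolSharpM T.D (logvAnalyticVal_analyticLogvVal (K := T.K)) (tOfIdeleData T.D (ideleDataOf T.D T.isVolumeInputOf))
          (fun u x => tqM T.D (ratChar u) u (natCast_ratChar_mem u) (ideleDataOf T.D T.isVolumeInputOf) x) M archPk archSub Ψ act Mmod region n lat sig split qData
          (fun u x => tqM_ne_zero T.D (ratChar u) u (natCast_ratChar_mem u) (ideleDataOf T.D T.isVolumeInputOf) x)
          (GenuineM.finite_ratPlaces_under_S T.D).toFinset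
          (fun u x hu => norm_tqM_eq_one_of_not_mem T.D (ratChar u) u (natCast_ratChar_mem u) (ideleDataOf T.D T.isVolumeInputOf) x
            fun hx => hu ((Set.Finite.mem_toFinset _).mpr ⟨x, hx⟩)))) qK := by
  have hhi' : l ≤ 159391 := by omega
  have hodd : Odd l := hl.odd_of_ne_two (by omega)
  have hpe : ¬ (3 : ℕ) ∣ 10 * l := by
    intro h
    rcases (Nat.Prime.dvd_mul (by norm_num : Nat.Prime 3)).mp h with h1 | h1
    · revert h1; norm_num
    · exact hne (((Nat.prime_dvd_prime_iff_eq (by norm_num : Nat.Prime 3) hl).mp h1).symm)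
  have hi : (l - 1) / 2 - 1 + 1 ≤ (l - 1) / 2 := by
    have h3 : 3 ≤ l := by omega
    omega
  obtain ⟨a₀, h1, h2, h3⟩ := RefBand.cells_frey160412424963707_three_band hlo hhi' hodd (i := (l - 1) / 2 - 1) (by omega)
  have hP : 10 * l * (7 ^ 3 * 29 ^ 5 * 151 ^ 2 * (2 ^ 4 * 5 ^ 16 * 97 * 919) * (3 ^ 27 * 13 ^ 4)).factorization 3 = l * 270 := by
    rw [RefBand.frey160412424963707_three_fac]; ring
  exact GenuineM.not_pilotKummerCompatHull_triple_of_not_hullCell_kFibre isABCTriple_frey160412424963707 T (placeOfPrimeQ 3 (by norm_num)) 3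
    (ratChar_placeOfPrimeQ 3 (by norm_num)) Nat.prime_three (by norm_num) (show (3 : ℕ) ≠ l by omega) (by norm_num) (e₀ := 10 * l) (P := 270)
    (i := (l - 1) / 2 - 1) (a₀ := a₀) hpe (GenuineK.absRamificationIdx_kOf_frey160412424963707_three T (by omega)) hP hi h1 h2 h3

end Summit.ABC.IUTFork.Conditional

end
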